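/-
Copyright (c) 2026. All rights reserved.
Released under Apache 2.0 license as described in the file LICENSE.
Authors: HodgeCM publication cell (pub-hodgecm), GR lane, seat GR-2 (`pub-hodgecm-own-hyp34`).
-/
import Mathlib.GroupTheory.Abelianization.Defs
import Literature.RepresentationTheory.HeisenbergGroup.SchrodingerPiGeneration
import Literature.RepresentationTheory.HeisenbergGroup.SymplecticAbelianization
import Literature.Geometry.Symplectic.GromovR4RelEndProofs
import HarnessLib

/-!
# The symplectic group of a symplectic vector space over a field of characteristic `0` is perfect

Topic `RepresentationTheory/HeisenbergGroup`; namespace `Literature.RepresentationTheory.HeisenbergGroup`.  KERNEL only: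
theorems; no definition, no named fact, no `axiom`, no proof hole.  Continuation of
`SymplecticAbelianization` (Folland's Prop. (4.21) in algebraic form for the MATRIX group: every homomorphism
`Matrix.symplecticGroup l 𝕜 →* A` to a commutative group is trivial, `char 𝕜 = 0`) and of
`ImplementerSectionRigidity` §4 ∕ `SchrodingerPiGeneration` §2 (the same for the coordinate model
`symplecticGroup (polar dotProductBilin)` of `𝕜^ι ⊕ 𝕜^ι`, through the surjection `transportSpPi`).

Here the statement is made COORDINATE-FREE: for a finite-dimensional vector space `V` over a field `K` of
characteristic `0` and a non-degenerate alternating bilinear form `φ` on `V`, the isometry group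
`Sp(V, φ) = Heisenberg.PseudoSymplectic.isometries φ ≤ GL(V)` has NO non-trivial homomorphism to a commutative group,
equivalently `commutator Sp(V, φ) = ⊤` — [Folland1989, §4.1 Prop. (4.21)] (stated there for `Sp(n, ℝ)` and its covers,
for continuous homomorphisms to the circle; the algebraic statement over any field with more than three elements is
classical, `Sp(V)` being generated by symplectic transvections, each a commutator), here for `char K = 0` by TRANSPORT:
a symplectic basis of `(V, φ)` ([McDuffSalamon2017, Thm. 2.1.3], the tree's
`Literature.Geometry.Symplectic.exists_symplecticBasis`) is a linear isomorphism `θ : V ≃ K^n × K^n` carrying `φ` to the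
standard form `p·q′ − p′·q = alt (polar dotProductBilin)`, conjugation by `θ` is a group isomorphism
`Sp(V, φ) ≃* symplecticGroup (polar dotProductBilin)` (`exists_isometriesCongr`), and the latter receives the surjection
`transportSpPi : Sp_{2n}(K) ↠ ·` from the perfect matrix group.

* §1 `Heisenberg.PseudoSymplectic.exists_isometriesCongr` — conjugation by a form-preserving linear isomorphism is an
  isomorphism of isometry groups (any commutative ring, any bilinear forms; an existence THEOREM — the tree's transport
  definition is `UnitaryGroup.symplecticGroupCongr`, nothing is redefined).
* §2 `exists_linearEquiv_alt_polar_dotProduct_eq` — symplectic coordinates: `θ : V ≃ₗ[K] K^n × K^n` with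
  `alt (polar dotProductBilin) (θ y) (θ y′) = φ y y′` (any field).
* §3 **`Heisenberg.PseudoSymplectic.monoidHom_isometries_eq_one`** (every `χ : Sp(V, φ) →* A` is `1`),
  **`Heisenberg.PseudoSymplectic.commutator_isometries_eq_top`**, and the `symplecticGroup B` forms
  `monoidHom_symplecticGroup_eq_one_of_nondegenerate` ∕ `commutator_symplecticGroup_eq_top_of_nondegenerate` for the
  symplectic group `Sp(alt B)` of the commutator form of ANY bilinear `B` with `alt B = B − Bᵀ` non-degenerate (the
  shape `symplecticGroup B` in which the tree's Heisenberg ∕ metaplectic files are written, e.g. the adelic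
  `Sp_𝐀(W)` and the printed `Sp_F(W) = GelbartRogawski1991.Prop311.ratSp` of [GelbartRogawski1991, §3.1]).

Use: the uniqueness of a splitting of a central extension over `Sp(V, φ)` — two homomorphic sections differ by a
homomorphism to the (abelian) kernel, which is trivial; cf. `Weil1964.AdelicMetaplecticRationalSectionUnique` for
the adelic metaplectic group of record.  Nothing of the cited sources is asserted; the tags are provenance.

## References
* [Folland1989] G. B. Folland, *Harmonic Analysis in Phase Space*, Ann. of Math. Stud. 122 (1989), §4.1 Prop. (4.21)
  (held text `book:folland1989-harmonic-analysis-phase-space`, p. 155).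
* [McDuffSalamon2017] D. McDuff, D. Salamon, *Introduction to Symplectic Topology*, 3rd ed. (2017), Thm. 2.1.3.
* [MoeglinVignerasWaldspurger1987] C. Mœglin, M.-F. Vignéras, J.-L. Waldspurger, LNM 1291 (1987), Chap. 2 II.1–II.2.
-/

set_option autoImplicit false

namespace Literature.RepresentationTheory.HeisenbergGroup

open Matrix

/-! ## §1 Transport of isometry groups along a form-preserving linear isomorphism -/

namespace Heisenberg.PseudoSymplectic

section Congr

variable {R : Type*} [CommRing R] {V V' : Type*} [AddCommGroup V] [Module R V] [AddCommGroup V'] [Module R V']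

/-- **Transport of structure for isometry groups**: a linear isomorphism `θ : V ≃ V′` with `φ′(θ v, θ w) = φ(v, w)`
induces a group isomorphism `e : isometries φ ≃* isometries φ′`, `e g = θ ∘ g ∘ θ⁻¹` (inverse `g′ ↦ θ⁻¹ ∘ g′ ∘ θ`).
Stated as an existence theorem (the tree's transport `def` is `UnitaryGroup.symplecticGroupCongr`, for the
`symplecticGroup B` presentation; no second transport definition is introduced). [cite: McDuffSalamon2017, Thm. 2.1.3] -/
theorem exists_isometriesCongr (φ : V →ₗ[R] V →ₗ[R] R) (φ' : V' →ₗ[R] V' →ₗ[R] R) (θ : V ≃ₗ[R] V')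
    (hθ : ∀ v w, φ' (θ v) (θ w) = φ v w) :
    ∃ e : isometries φ ≃* isometries φ',
      ∀ g : isometries φ, ((e g : isometries φ') : V' ≃ₗ[R] V') = (θ.symm.trans (g : V ≃ₗ[R] V)).trans θ :=
  ⟨{ toFun := fun g => ⟨(θ.symm.trans (g : V ≃ₗ[R] V)).trans θ, fun v w => by
        have hg : ∀ v w : V, φ ((g : V ≃ₗ[R] V) v) ((g : V ≃ₗ[R] V) w) = φ v w := g.2
        simp only [LinearEquiv.trans_apply]
        rw [hθ, hg, ← hθ (θ.symm v) (θ.symm w), LinearEquiv.apply_symm_apply, LinearEquiv.apply_symm_apply]⟩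
     invFun := fun g' => ⟨(θ.trans (g' : V' ≃ₗ[R] V')).trans θ.symm, fun v w => by
        have hg : ∀ v w : V', φ' ((g' : V' ≃ₗ[R] V') v) ((g' : V' ≃ₗ[R] V') w) = φ' v w := g'.2
        simp only [LinearEquiv.trans_apply]
        rw [← hθ, LinearEquiv.apply_symm_apply, LinearEquiv.apply_symm_apply, hg, hθ]⟩
     left_inv := fun g => Subtype.ext (LinearEquiv.ext fun v => by simp)
     right_inv := fun g' => Subtype.ext (LinearEquiv.ext fun v => by simp)
     map_mul' := fun g g' => Subtype.ext (LinearEquiv.ext fun v => by simp [LinearEquiv.mul_apply]) },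
    fun _ => rfl⟩

end Congr

end Heisenberg.PseudoSymplectic

/-! ## §2 Symplectic coordinates (linear Darboux) over any field -/

section Coordinates

variable {K : Type*} [Field K] {V : Type*} [AddCommGroup V] [Module K V] [FiniteDimensional K V]

/-- **Symplectic coordinates**: a non-degenerate alternating form `φ` on a finite-dimensional `K`-space `V` is carried
by a linear isomorphism `θ : V ≃ K^n × K^n` (the coordinates in a symplectic basis) to the standard form
`p·q′ − p′·q = alt (polar dotProductBilin)`. [cite: McDuffSalamon2017, Thm. 2.1.3] -/
theorem exists_linearEquiv_alt_polar_dotProduct_eq (φ : LinearMap.BilinForm K V) (hA : φ.IsAlt)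
    (hN : φ.Nondegenerate) :
    ∃ (n : ℕ) (θ : V ≃ₗ[K] (Fin n → K) × (Fin n → K)),
      ∀ y y' : V, alt (polar (dotProductBilin K K (m := Fin n))) (θ y) (θ y') = φ y y' := by
  obtain ⟨n, b, h11, h22, h12⟩ := Geometry.Symplectic.exists_symplecticBasis φ hA hN
  have h21 : ∀ i j, φ (b (Sum.inr i)) (b (Sum.inl j)) = -(if j = i then (1 : K) else 0) := fun i j => by
    rw [← hA.neg_eq, h12]
  refine ⟨n, b.equivFun.trans (LinearEquiv.sumArrowLequivProdArrow (Fin n) (Fin n) K K), fun y y' => ?_⟩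
  set c : Fin n ⊕ Fin n → K := b.equivFun y with hc
  set c' : Fin n ⊕ Fin n → K := b.equivFun y' with hc'
  have hy : y = ∑ a, c a • b a := (b.sum_equivFun y).symm
  have hy' : y' = ∑ a, c' a • b a := (b.sum_equivFun y').symm
  have hL : φ y y' = ∑ i, c (Sum.inl i) * c' (Sum.inr i) - ∑ i, c (Sum.inr i) * c' (Sum.inl i) := by
    conv_lhs => rw [hy, hy']
    simp only [map_sum, map_add, LinearMap.add_apply, LinearMap.sum_apply, map_smul, LinearMap.smul_apply,
      smul_eq_mul, Fintype.sum_sum_type, h11, h22, h12, h21, mul_zero, Finset.sum_const_zero, add_zero, zero_add,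
      mul_ite, mul_one, mul_neg, Finset.sum_ite_eq, Finset.sum_ite_eq', Finset.mem_univ, if_true,
      Finset.sum_neg_distrib]
    rw [show (∑ x, c' (Sum.inr x) * c (Sum.inl x)) = ∑ x, c (Sum.inl x) * c' (Sum.inr x) from
        Finset.sum_congr rfl fun x _ => mul_comm _ _,
      show (∑ x, c' (Sum.inl x) * c (Sum.inr x)) = ∑ x, c (Sum.inr x) * c' (Sum.inl x) from
        Finset.sum_congr rfl fun x _ => mul_comm _ _]
    ring
  have hR1 : ((b.equivFun.trans (LinearEquiv.sumArrowLequivProdArrow (Fin n) (Fin n) K K)) y).1 ⬝ᵥ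
      ((b.equivFun.trans (LinearEquiv.sumArrowLequivProdArrow (Fin n) (Fin n) K K)) y').2 =
        ∑ i, c (Sum.inl i) * c' (Sum.inr i) := by
    simp only [dotProduct, LinearEquiv.trans_apply, LinearEquiv.sumArrowLequivProdArrow_apply_fst,
      LinearEquiv.sumArrowLequivProdArrow_apply_snd, hc, hc']
  have hR2 : ((b.equivFun.trans (LinearEquiv.sumArrowLequivProdArrow (Fin n) (Fin n) K K)) y').1 ⬝ᵥ
      ((b.equivFun.trans (LinearEquiv.sumArrowLequivProdArrow (Fin n) (Fin n) K K)) y).2 =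
        ∑ i, c (Sum.inr i) * c' (Sum.inl i) := by
    simp only [dotProduct, LinearEquiv.trans_apply, LinearEquiv.sumArrowLequivProdArrow_apply_fst,
      LinearEquiv.sumArrowLequivProdArrow_apply_snd, hc, hc']
    exact Finset.sum_congr rfl fun x _ => mul_comm _ _
  rw [alt_apply, polar_apply, polar_apply, dotProductBilin_apply_apply, dotProductBilin_apply_apply, hR1, hR2, hL]

end Coordinates

/-! ## §3 Perfectness of `Sp(V, φ)` -/

section Perfect

variable {K : Type*} [Field K] [CharZero K] {V : Type*} [AddCommGroup V] [Module K V] [FiniteDimensional K V]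
variable {A : Type*} [CommGroup A]

/-- transfer along a surjection: if `G` has no non-trivial homomorphism to `A`, neither has any quotient of `G`.
[cite: Folland1989, §4.1 Prop. (4.21)] -/
private theorem monoidHom_eq_one_of_surjective {G G' : Type*} [Group G] [Group G'] (π : G →* G')
    (hπ : Function.Surjective π) (hG : ∀ χ : G →* A, χ = 1) (χ : G' →* A) : χ = 1 :=
  MonoidHom.ext fun g' => by
    obtain ⟨g, rfl⟩ := hπ g'
    exact DFunLike.congr_fun (hG (χ.comp π)) g

/-- **`Sp(V, φ)` has no non-trivial homomorphism to a commutative group** — `V` a finite-dimensional vector space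
over a field `K` of characteristic `0`, `φ` a non-degenerate alternating bilinear form, `Sp(V, φ) = isometries φ`:
every `χ : Sp(V, φ) →* A`, `A` commutative, is `1`.  (Transport of `SymplecticMatrix.hom_eq_one` along symplectic
coordinates and `transportSpPi`.) [cite: Folland1989, §4.1 Prop. (4.21)] -/
theorem Heisenberg.PseudoSymplectic.monoidHom_isometries_eq_one (φ : LinearMap.BilinForm K V) (hA : φ.IsAlt)
    (hN : φ.Nondegenerate) (χ : Heisenberg.PseudoSymplectic.isometries φ →* A) : χ = 1 := by
  obtain ⟨n, θ, hθ⟩ := exists_linearEquiv_alt_polar_dotProduct_eq φ hA hN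
  have hθ' : ∀ v w : (Fin n → K) × (Fin n → K),
      φ (θ.symm v) (θ.symm w) = alt (polar (dotProductBilin K K (m := Fin n))) v w := fun v w => by
    rw [← hθ, LinearEquiv.apply_symm_apply, LinearEquiv.apply_symm_apply]
  obtain ⟨e, -⟩ :
      ∃ e : symplecticGroup (polar (dotProductBilin K K (m := Fin n))) ≃* Heisenberg.PseudoSymplectic.isometries φ,
        ∀ g, ((e g : Heisenberg.PseudoSymplectic.isometries φ) : V ≃ₗ[K] V) =
          (θ.symm.symm.trans (g : ((Fin n → K) × (Fin n → K)) ≃ₗ[K] ((Fin n → K) × (Fin n → K)))).trans θ.symm :=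
    Heisenberg.PseudoSymplectic.exists_isometriesCongr (alt (polar (dotProductBilin K K (m := Fin n)))) φ θ.symm hθ'
  exact monoidHom_eq_one_of_surjective (e.toMonoidHom.comp (transportSpPi K (Fin n)))
    (e.surjective.comp (transportSpPi_surjective K (Fin n))) (fun χ' => SymplecticMatrix.hom_eq_one χ') χ

/-- **`Sp(V, φ)` is perfect**: its commutator subgroup is the whole group. [cite: Folland1989, §4.1 Prop. (4.21)] -/
theorem Heisenberg.PseudoSymplectic.commutator_isometries_eq_top (φ : LinearMap.BilinForm K V) (hA : φ.IsAlt)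
    (hN : φ.Nondegenerate) : commutator (Heisenberg.PseudoSymplectic.isometries φ) = ⊤ := by
  rw [← Abelianization.ker_of,
    Heisenberg.PseudoSymplectic.monoidHom_isometries_eq_one φ hA hN
      (Abelianization.of (G := Heisenberg.PseudoSymplectic.isometries φ))]
  exact MonoidHom.ker_one

omit [CharZero K] [FiniteDimensional K V] in
/-- the commutator form `alt B = B − Bᵀ` of any bilinear `B` is alternating. [cite: McDuffSalamon2017, Thm. 2.1.3] -/
theorem isAlt_alt (B : V →ₗ[K] V →ₗ[K] K) : (alt B).IsAlt := fun w => by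
  change alt B w w = 0
  rw [alt_apply, sub_self]

/-- **`symplecticGroup B` form**: for ANY bilinear `B` on `V` whose commutator form `alt B = B − Bᵀ` is non-degenerate
(e.g. `B = polar β` of a perfect pairing, or `B = ½ φ` of a symplectic `φ`), every homomorphism from the symplectic
group `Sp(alt B) = symplecticGroup B` to a commutative group is trivial. [cite: Folland1989, §4.1 Prop. (4.21)] -/
theorem monoidHom_symplecticGroup_eq_one_of_nondegenerate (B : V →ₗ[K] V →ₗ[K] K) (hN : (alt B).Nondegenerate)
    (χ : symplecticGroup B →* A) : χ = 1 :=
  Heisenberg.PseudoSymplectic.monoidHom_isometries_eq_one (alt B) (isAlt_alt B) hN χ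

/-- … equivalently `commutator (symplecticGroup B) = ⊤`. [cite: Folland1989, §4.1 Prop. (4.21)] -/
theorem commutator_symplecticGroup_eq_top_of_nondegenerate (B : V →ₗ[K] V →ₗ[K] K)
    (hN : (alt B).Nondegenerate) : commutator (symplecticGroup B) = ⊤ :=
  Heisenberg.PseudoSymplectic.commutator_isometries_eq_top (alt B) (isAlt_alt B) hN

open scoped IsMulCommutative in
/-- **Uniqueness of lifts through a central-kernel homomorphism** (the use of perfectness): if `π : M →* S` has
central kernel and `s₁ s₂ : Sp(V, φ) →* M` satisfy `π ∘ s₁ = π ∘ s₂`, then `s₁ = s₂` — the quotients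
`(s₁ g)⁻¹ · s₂ g` form a homomorphism to the commutative group `center M`, hence are trivial.
[cite: MoeglinVignerasWaldspurger1987, Chap. 2 II.1 (B)] -/
theorem Heisenberg.PseudoSymplectic.eq_of_comp_eq_of_ker_le_center (φ : LinearMap.BilinForm K V) (hA : φ.IsAlt)
    (hN : φ.Nondegenerate) {M S : Type*} [Group M] [Group S] (π : M →* S) (hker : π.ker ≤ Subgroup.center M)
    (s₁ s₂ : Heisenberg.PseudoSymplectic.isometries φ →* M) (h : ∀ g, π (s₁ g) = π (s₂ g)) : s₁ = s₂ := by
  have hc : ∀ g, (s₁ g)⁻¹ * s₂ g ∈ Subgroup.center M := fun g =>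
    hker ((MonoidHom.mem_ker).2 (by rw [map_mul, map_inv, h g, inv_mul_cancel]))
  have hz : ∀ g (m : M), m * ((s₁ g)⁻¹ * s₂ g) = (s₁ g)⁻¹ * s₂ g * m := fun g m =>
    Subgroup.mem_center_iff.1 (hc g) m
  -- the quotient map into the commutative group `center M`
  let δ : Heisenberg.PseudoSymplectic.isometries φ →* Subgroup.center M :=
    MonoidHom.mk' (fun g => ⟨(s₁ g)⁻¹ * s₂ g, hc g⟩) fun g g' => Subtype.ext (by
      show (s₁ (g * g'))⁻¹ * s₂ (g * g') = (s₁ g)⁻¹ * s₂ g * ((s₁ g')⁻¹ * s₂ g')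
      rw [map_mul, map_mul, _root_.mul_inv_rev]
      calc (s₁ g')⁻¹ * (s₁ g)⁻¹ * (s₂ g * s₂ g')
          = (s₁ g')⁻¹ * ((s₁ g)⁻¹ * s₂ g) * s₂ g' := by simp only [mul_assoc]
        _ = (s₁ g)⁻¹ * s₂ g * (s₁ g')⁻¹ * s₂ g' := by rw [hz g (s₁ g')⁻¹]
        _ = (s₁ g)⁻¹ * s₂ g * ((s₁ g')⁻¹ * s₂ g') := by simp only [mul_assoc])
  have hδ : δ = 1 := Heisenberg.PseudoSymplectic.monoidHom_isometries_eq_one φ hA hN δ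
  refine MonoidHom.ext fun g => ?_
  have hg : (s₁ g)⁻¹ * s₂ g = 1 := by
    have h1 := congrArg (fun t : Heisenberg.PseudoSymplectic.isometries φ →* Subgroup.center M =>
      ((t g : Subgroup.center M) : M)) hδ
    exact h1
  exact inv_mul_eq_one.1 hg

end Perfect

end Literature.RepresentationTheory.HeisenbergGroup
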